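import Summits.HodgeConjecture.CorCM.Census.TwistGenerationDescent

/-!
# Uniform twist generation, II: THE MODEL ALONG A DATUM `θ : G ≃ ℤ/2n × B` — centres, deviation distance, potential, the near class,
# profile types and the residual vocabulary

COR-CM (cell `pub-hodgecm2`), count-neutral kernel combinatorics by the binder seat b09 (gen 36; lane UNIFORM TWIST GENERATION, part II),
in seat b09ʼs intrinsic currency (`CMF G c`, `rt`, `oflipCM`, `typeSum`: `CorCM/Prior/AllgGroup1.lean`, `Census/BlockParityLaw.lean`) used BY NAME,
following the datum style of seat b23ʼs `Census/ClockTypesDictionary.lean` (there `n = 2`).  Bookkeeping definitions with bodies (`cst`, `ddist`,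
`pot`, `nearCl`, `prof`, `catom`, `trans`, `wplus`, `resVec`) + theorems; no `Prop`-valued definition (the near class is a `Set`), no `decide`,
no certificate, no named fact, no `sorry`.
HONEST FRAMING: `HC_CM` is NOT proved, here or anywhere in the tree; nothing here is a period or a headline.

THE DATUM.  `θ : G ≃ ZMod (2n) × B` with `θ (PQ) = θ P + θ Q` and `θ c = (n, 0)` (`B` any finite group, written additively; `n ≥ 1`): `G ≅ ℤ/2n × B`,
`c = (n, 0)` — EVERY finite group with a central cyclic direct factor of even order `2n` containing `c` as its element of order two; for `n = 2^j`
these are the `2^{j+1}`-ic twists of the lane note (`HOME/pub-hodgecm2-b09/lean-g32/QUARTIC-TWIST.md` PART V normal form).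

* §1 datum lemmas and `ℤ/2n` arithmetic (`val_sub_eq`, `lt_iff_not_lt_add_n`);
* §2 **centres** `cst a = θ⁻¹(arc a × B)`, `arc a = {x | (x − a).val < n}` (the `B`-constant arc types; `rt_cst`: `(cst a)·Q⁻¹ = cst (a − (θQ).1)`);
* §3 **deviation distance** `ddist T Ψ = |T ∖ Ψ|` (number of places where `Ψ` deviates from `T`; `ddist_rt`, the flip law `ddist_oflipCM_of_mem_sdiff`;
  the rest of the near-class calculus is part III `Census/TwistGenerationCover.lean`);
* §4 **potential** `pot Ψ = min_a ddist (cst a) Ψ` (`pot_rt`) and **the near class** `nearCl a` («`a` is a nearest centre of `Ψ`, and strictly nearer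
  than every centre other than `a − 1`» — unique nearest centre, or the UPPER end of an adjacent tie);
* §5 **profile types** `prof Q` (columns in `Q` at arc `1`, the rest at arc `0`), **canonical atoms** `catom x b = (cst x)^{(θ⁻¹(x,b))}`, the
  **transfer** `trans a x b = [cst a^{(θ⁻¹(x,b))}] − [cst a] − [cst (a+1)^{(θ⁻¹(x,b))}] + [cst (a+1)]`, the **upper star**
  `wplus x = Σ_b [catom x b] − (|B| − 1)[cst x] − [cst (x+1)]` and the residual family `resVec b₀` (centres and canonical atoms off the
  base column `b₀`) — the vocabulary of parts IV–VI.

## References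
* [Pohlmann1968] H. Pohlmann, Algebraic cycles on abelian varieties of complex multiplication type, Ann. of Math. 88 (1968), Thm 1.
* [Milne1999] J. S. Milne, Lefschetz motives and the Tate conjecture, Compositio Math. 117 (1999), Prop. 2.1, p. 54.
-/

namespace Summit.HodgeConjecture.CorCM.Census.TwistGeneration

open Finset
open Summit.HodgeConjecture.CorCM.Prior.AllgGroup.RfwfAllgGroup
open Summit.HodgeConjecture.CorCM.Census.BlockParity
open scoped symmDiff

noncomputable section

/-- `2n ≠ 0` for `n ≠ 0` (so that `ZMod (2n)` is a finite ring with `val`). [folklore] -/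
instance instNeZeroTwoMulTwist (n : ℕ) [NeZero n] : NeZero (2 * n) := ⟨by have := NeZero.ne n; omega⟩

variable {G : Type*} [Group G] [Fintype G] [DecidableEq G] {c : G}
variable {B : Type} [AddGroup B]
variable {n : ℕ} [NeZero n] (θ : G ≃ ZMod (2 * n) × B)

/-! ## §1 The datum and `ℤ/2n` arithmetic -/

section Arith

/-- `val` of a difference in `ℤ/2n`. [folklore] -/
theorem val_sub_eq (v a : ZMod (2 * n)) : (v - a).val = if a.val ≤ v.val then v.val - a.val else v.val + 2 * n - a.val := by
  split_ifs with h
  · exact ZMod.val_sub h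
  · have h1 : (a - v).val = a.val - v.val := ZMod.val_sub (by omega)
    have h2 : a - v ≠ 0 := by
      intro h0
      have := congrArg ZMod.val h0
      rw [h1, ZMod.val_zero] at this
      omega
    rw [show v - a = -(a - v) by ring, ZMod.neg_val, if_neg h2, h1]
    have := ZMod.val_lt a
    omega

/-- `val (n : ℤ/2n) = n`. [folklore] -/
theorem val_n : ((n : ℕ) : ZMod (2 * n)).val = n := by
  rw [ZMod.val_natCast]
  have := NeZero.ne n
  exact Nat.mod_eq_of_lt (by omega)

omit [NeZero n] in
/-- `n + n = 0` in `ℤ/2n`. [folklore] -/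
theorem n_add_n : ((n : ℕ) : ZMod (2 * n)) + n = 0 := by
  rw [← Nat.cast_add, show n + n = 2 * n by ring, ZMod.natCast_self]

/-- `val (v + n)` in `ℤ/2n`. [folklore] -/
theorem val_add_n (v : ZMod (2 * n)) : (v + n).val = if v.val < n then v.val + n else v.val - n := by
  rw [ZMod.val_add, val_n]
  have hv := ZMod.val_lt v
  split_ifs with h
  · exact Nat.mod_eq_of_lt (by omega)
  · rw [Nat.mod_eq_sub_mod (by omega), Nat.mod_eq_of_lt (by omega)]
    omega

/-- **Antipodality**: exactly one of `v`, `v + n` lies in the arc `[0, n)`. [folklore] -/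
theorem lt_iff_not_lt_add_n (v : ZMod (2 * n)) : v.val < n ↔ ¬ (v + n).val < n := by
  rw [val_add_n]
  have hv := ZMod.val_lt v
  split_ifs with h <;> omega

end Arith

section Datum

omit [Fintype G] [DecidableEq G] [NeZero n] in
/-- A datum sends `1` to `0`. [folklore] -/
theorem map_one_eq (hθ : ∀ P Q : G, θ (P * Q) = θ P + θ Q) : θ 1 = 0 := by
  have h : θ 1 + 0 = θ 1 + θ 1 := by rw [add_zero, ← hθ, one_mul]
  exact (add_left_cancel h).symm

omit [Fintype G] [DecidableEq G] [NeZero n] in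
/-- A datum sends inverses to negatives. [folklore] -/
theorem map_inv_eq (hθ : ∀ P Q : G, θ (P * Q) = θ P + θ Q) (P : G) : θ P⁻¹ = -θ P :=
  eq_neg_of_add_eq_zero_left (by rw [← hθ, inv_mul_cancel, map_one_eq θ hθ])

omit [Fintype G] [DecidableEq G] [NeZero n] in
/-- The inverse datum is multiplicative. [folklore] -/
theorem symm_add (hθ : ∀ P Q : G, θ (P * Q) = θ P + θ Q) (g h : ZMod (2 * n) × B) : θ.symm (g + h) = θ.symm g * θ.symm h :=
  θ.injective (by rw [hθ, Equiv.apply_symm_apply, Equiv.apply_symm_apply, Equiv.apply_symm_apply])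

omit [Fintype G] [DecidableEq G] [NeZero n] in
/-- **`c` is an involution.** [folklore] -/
theorem c_mul_c (hθ : ∀ P Q : G, θ (P * Q) = θ P + θ Q) (hθc : θ c = (((n : ℕ) : ZMod (2 * n)), 0)) : c * c = 1 :=
  θ.injective (by rw [hθ, hθc, map_one_eq θ hθ, Prod.mk_add_mk, add_zero, n_add_n]; rfl)

omit [Fintype G] [DecidableEq G] in
/-- **`c ≠ 1`.** [folklore] -/
theorem c_ne_one (hθ : ∀ P Q : G, θ (P * Q) = θ P + θ Q) (hθc : θ c = (((n : ℕ) : ZMod (2 * n)), 0)) : c ≠ 1 := by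
  intro h
  have h2 : (((n : ℕ) : ZMod (2 * n)), (0 : B)) = 0 := by rw [← hθc, h, map_one_eq θ hθ]
  have h3 := congrArg ZMod.val (Prod.ext_iff.mp h2).1
  rw [val_n, Prod.fst_zero, ZMod.val_zero] at h3
  exact NeZero.ne n h3

omit [Fintype G] [DecidableEq G] [NeZero n] in
/-- **`c` is central.** [folklore] -/
theorem mul_comm_c (hθ : ∀ P Q : G, θ (P * Q) = θ P + θ Q) (hθc : θ c = (((n : ℕ) : ZMod (2 * n)), 0)) (x : G) : x * c = c * x :=
  θ.injective (by
    rw [hθ, hθ, hθc]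
    exact Prod.ext (by simp only [Prod.fst_add]; exact add_comm _ _) (by simp only [Prod.snd_add, add_zero, zero_add]))

omit [Fintype G] [DecidableEq G] [NeZero n] in
/-- `c · θ⁻¹(x, b) = θ⁻¹(x + n, b)`. [folklore] -/
theorem c_mul_symm (hθ : ∀ P Q : G, θ (P * Q) = θ P + θ Q) (hθc : θ c = (((n : ℕ) : ZMod (2 * n)), 0)) (x : ZMod (2 * n)) (b : B) :
    c * θ.symm (x, b) = θ.symm (x + n, b) :=
  θ.injective (by rw [hθ, hθc, Equiv.apply_symm_apply, Equiv.apply_symm_apply, Prod.mk_add_mk, zero_add, add_comm])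

omit [Fintype G] [DecidableEq G] [NeZero n] in
/-- First coordinate of `θ (c x)`. [folklore] -/
theorem fst_c_mul (hθ : ∀ P Q : G, θ (P * Q) = θ P + θ Q) (hθc : θ c = (((n : ℕ) : ZMod (2 * n)), 0)) (x : G) :
    (θ (c * x)).1 = (θ x).1 + n := by
  rw [hθ, hθc, Prod.fst_add, add_comm]

omit [Fintype G] [DecidableEq G] [NeZero n] in
/-- Second coordinate of `θ (c x)`. [folklore] -/
theorem snd_c_mul (hθ : ∀ P Q : G, θ (P * Q) = θ P + θ Q) (hθc : θ c = (((n : ℕ) : ZMod (2 * n)), 0)) (x : G) :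
    (θ (c * x)).2 = (θ x).2 := by
  rw [hθ, hθc, Prod.snd_add, zero_add]

end Datum

/-! ## §2 Centres -/

section Centres

/-- **The centre `cst a = θ⁻¹(arc a × B)`**, `arc a = {x : ℤ/2n | (x − a).val < n}`: the `B`-constant arc type at `a`. [folklore] -/
def cst (hθ : ∀ P Q : G, θ (P * Q) = θ P + θ Q) (hθc : θ c = (((n : ℕ) : ZMod (2 * n)), 0)) (a : ZMod (2 * n)) : CMF G c :=
  ⟨univ.filter fun P => ((θ P).1 - a).val < n, by
    intro x
    simp only [mem_filter, mem_univ, true_and, fst_c_mul θ hθ hθc, add_sub_right_comm]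
    exact lt_iff_not_lt_add_n _⟩

variable (hθ : ∀ P Q : G, θ (P * Q) = θ P + θ Q) (hθc : θ c = (((n : ℕ) : ZMod (2 * n)), 0))

/-- Membership in a centre. [folklore] -/
@[simp] theorem mem_cst (a : ZMod (2 * n)) (P : G) : P ∈ (cst θ hθ hθc a).1 ↔ ((θ P).1 - a).val < n := by
  simp [cst]

/-- Membership of `θ⁻¹(x, b)` in a centre. [folklore] -/
theorem symm_mem_cst (a x : ZMod (2 * n)) (b : B) : θ.symm (x, b) ∈ (cst θ hθ hθc a).1 ↔ (x - a).val < n := by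
  rw [mem_cst, Equiv.apply_symm_apply]

/-- `θ⁻¹(x, b)` lies in the centre `cst x`. [folklore] -/
theorem symm_self_mem_cst (x : ZMod (2 * n)) (b : B) : θ.symm (x, b) ∈ (cst θ hθ hθc x).1 := by
  rw [symm_mem_cst, sub_self, ZMod.val_zero]
  exact Nat.pos_of_ne_zero (NeZero.ne n)

/-- **Base change of a centre is a centre**: `(cst a)·Q⁻¹ = cst (a − (θQ).1)`. [folklore] -/
theorem rt_cst (Q : G) (a : ZMod (2 * n)) : rt c Q (cst θ hθ hθc a) = cst θ hθ hθc (a - (θ Q).1) := by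
  apply Subtype.ext; ext P
  rw [mem_rt, mem_cst, mem_cst, hθ, Prod.fst_add, show (θ P).1 + (θ Q).1 - a = (θ P).1 - (a - (θ Q).1) by abel]

/-- The conjugate of a centre: `(cst a)·c = cst (a + n)`. [folklore] -/
theorem rt_self_cst (a : ZMod (2 * n)) : rt c c (cst θ hθ hθc a) = cst θ hθ hθc (a + n) := by
  rw [rt_cst, hθc]
  congr 1
  rw [sub_eq_iff_eq_add, add_assoc, n_add_n, add_zero]

/-- Centres are translates of one another: `cst a = (cst 0)·(θ⁻¹(−a, 0))⁻¹`. [folklore] -/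
theorem cst_eq_rt (a : ZMod (2 * n)) : cst θ hθ hθc a = rt c (θ.symm (-a, 0)) (cst θ hθ hθc 0) := by
  rw [rt_cst, Equiv.apply_symm_apply, zero_sub, neg_neg]

end Centres

/-! ## §3 Deviation distance -/

section Dist

/-- **Deviation distance** `ddist T Ψ = |T ∖ Ψ|`: the number of places where `Ψ` deviates from `T`. [folklore] -/
def ddist (T Ψ : CMF G c) : ℕ := (T.1 \ Ψ.1).card

/-- `ddist T T = 0`. [folklore] -/
theorem ddist_self (T : CMF G c) : ddist T T = 0 := by
  rw [ddist, sdiff_self, Finset.bot_eq_empty, card_empty]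

/-- **Base change preserves deviation distance.** [folklore] -/
theorem ddist_rt (Q : G) (T Ψ : CMF G c) : ddist (rt c Q T) (rt c Q Ψ) = ddist T Ψ := by
  unfold ddist
  have h : (rt c Q T).1 \ (rt c Q Ψ).1 = (T.1 \ Ψ.1).image fun P => P * Q⁻¹ := by
    ext P
    simp only [mem_sdiff, mem_rt, mem_image]
    constructor
    · intro hP; exact ⟨P * Q, hP, by rw [mul_inv_cancel_right]⟩
    · rintro ⟨R, hR, rfl⟩; rw [inv_mul_cancel_right]; exact hR
  rw [h, card_image_of_injective _ (mul_left_injective Q⁻¹)]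

/-- Membership in a flipped type. [folklore] -/
theorem mem_oflipCM_iff' (hc2 : c * c = 1) (t : G) (Ψ : CMF G c) (x : G) :
    x ∈ (oflipCM c hc2 t Ψ).1 ↔ ¬ (x ∈ Ψ.1 ↔ x ∈ orb c t) := by
  change x ∈ Ψ.1 ∆ orb c t ↔ _
  rw [Finset.mem_symmDiff]
  tauto

/-- **Flip law, deviation place**: flipping `Ψ` at a place `t ∈ T ∖ Ψ` lowers `ddist T` by one. [folklore] -/
theorem ddist_oflipCM_of_mem_sdiff (hc2 : c * c = 1) {T Ψ : CMF G c} {t : G} (ht : t ∈ T.1 \ Ψ.1) :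
    ddist T (oflipCM c hc2 t Ψ) + 1 = ddist T Ψ := by
  unfold ddist
  rw [dev_oflip c hc2 (mem_sdiff.mp ht).1 (mem_sdiff.mp ht).2, card_erase_add_one ht]

end Dist

/-! ## §4 The potential and the near class -/

section Pot

variable (hθ : ∀ P Q : G, θ (P * Q) = θ P + θ Q) (hθc : θ c = (((n : ℕ) : ZMod (2 * n)), 0))

/-- **The potential** `pot Ψ = min_a ddist (cst a) Ψ`: the Hamming distance from `Ψ` to the nearest centre. [folklore] -/
def pot (Ψ : CMF G c) : ℕ := univ.inf' ⟨0, mem_univ _⟩ fun a : ZMod (2 * n) => ddist (cst θ hθ hθc a) Ψ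

/-- The potential is at most the distance to any centre. [folklore] -/
theorem pot_le (Ψ : CMF G c) (a : ZMod (2 * n)) : pot θ hθ hθc Ψ ≤ ddist (cst θ hθ hθc a) Ψ :=
  Finset.inf'_le _ (mem_univ a)

/-- The potential is attained at some centre. [folklore] -/
theorem exists_pot_eq (Ψ : CMF G c) : ∃ a : ZMod (2 * n), pot θ hθ hθc Ψ = ddist (cst θ hθ hθc a) Ψ := by
  obtain ⟨a, -, ha⟩ := Finset.exists_mem_eq_inf' (s := (univ : Finset (ZMod (2 * n)))) ⟨0, mem_univ _⟩
    (fun a : ZMod (2 * n) => ddist (cst θ hθ hθc a) Ψ)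
  exact ⟨a, ha⟩

/-- **The potential is base-change invariant.** [folklore] -/
theorem pot_rt (Q : G) (Ψ : CMF G c) : pot θ hθ hθc (rt c Q Ψ) = pot θ hθ hθc Ψ := by
  apply le_antisymm
  · obtain ⟨a, ha⟩ := exists_pot_eq θ hθ hθc Ψ
    refine (pot_le θ hθ hθc (rt c Q Ψ) (a - (θ Q).1)).trans ?_
    rw [← rt_cst θ hθ hθc Q a, ddist_rt, ← ha]
  · obtain ⟨a, ha⟩ := exists_pot_eq θ hθ hθc (rt c Q Ψ)
    refine (pot_le θ hθ hθc Ψ (a + (θ Q).1)).trans ?_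
    rw [ha, ← ddist_rt Q, rt_cst θ hθ hθc, add_sub_cancel_right]

/-- **The near class** `nearCl a`: the types `Ψ` for which `a` is a nearest centre, strictly nearer than every centre other than `a` and
`a − 1` (so `a` is the unique nearest centre, or the UPPER end of a tie between the adjacent centres `a − 1, a`). [folklore] -/
def nearCl (a : ZMod (2 * n)) : Set (CMF G c) :=
  {Ψ | ∀ a' : ZMod (2 * n), ddist (cst θ hθ hθc a) Ψ ≤ ddist (cst θ hθ hθc a') Ψ ∧
    (a' ≠ a → a' ≠ a - 1 → ddist (cst θ hθ hθc a) Ψ < ddist (cst θ hθ hθc a') Ψ)}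

/-- Membership in the near class. [folklore] -/
theorem mem_nearCl_iff (a : ZMod (2 * n)) (Ψ : CMF G c) : Ψ ∈ nearCl θ hθ hθc a ↔
    ∀ a' : ZMod (2 * n), ddist (cst θ hθ hθc a) Ψ ≤ ddist (cst θ hθ hθc a') Ψ ∧
      (a' ≠ a → a' ≠ a - 1 → ddist (cst θ hθ hθc a) Ψ < ddist (cst θ hθ hθc a') Ψ) := Iff.rfl

end Pot

/-! ## §5 Profile types and the residual vocabulary -/

section Vocabulary

variable (hθ : ∀ P Q : G, θ (P * Q) = θ P + θ Q) (hθc : θ c = (((n : ℕ) : ZMod (2 * n)), 0))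

/-- **The canonical atom** of the place `(x, b)`: the centre `cst x` flipped at `θ⁻¹(x, b)` (its column `b` becomes the arc `x + 1`). [folklore] -/
def catom (hc2 : c * c = 1) (x : ZMod (2 * n)) (b : B) : CMF G c := oflipCM c hc2 (θ.symm (x, b)) (cst θ hθ hθc x)

/-- The canonical atom deviates from its centre exactly at its place: `cst x ∖ catom x b = {θ⁻¹(x, b)}`. [folklore] -/
theorem sdiff_catom (hc2 : c * c = 1) (x : ZMod (2 * n)) (b : B) :
    (cst θ hθ hθc x).1 \ (catom θ hθ hθc hc2 x b).1 = {θ.symm (x, b)} := by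
  have ht := symm_self_mem_cst θ hθ hθc x b
  have hct : c * θ.symm (x, b) ∉ (cst θ hθ hθc x).1 := ((cst θ hθ hθc x).2 _).mp ht
  ext y
  rw [mem_sdiff, catom, mem_oflipCM_iff' hc2, mem_orb, mem_singleton]
  constructor
  · rintro ⟨hy, hy'⟩
    rw [not_not] at hy'
    rcases hy'.mp hy with h | h
    · exact h
    · exact absurd hy (h ▸ hct)
  · rintro rfl
    exact ⟨ht, not_not.mpr (iff_of_true ht (Or.inl rfl))⟩

/-- **The transfer relation** `trans a x b = [cst a^{(θ⁻¹(x,b))}] − [cst a] − [cst (a+1)^{(θ⁻¹(x,b))}] + [cst (a+1)]`: the atom-minus-centre vector of the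
place `(x, b)` is the same at the adjacent centres `a`, `a + 1` (a Hodge relation when the place is interior to both arcs). [folklore] -/
def trans (hc2 : c * c = 1) (a x : ZMod (2 * n)) (b : B) : CMF G c →₀ ℤ :=
  Finsupp.single (oflipCM c hc2 (θ.symm (x, b)) (cst θ hθ hθc a)) 1 - Finsupp.single (cst θ hθ hθc a) 1
    - Finsupp.single (oflipCM c hc2 (θ.symm (x, b)) (cst θ hθ hθc (a + 1))) 1 + Finsupp.single (cst θ hθ hθc (a + 1)) 1

/-- **The residual vectors about a base column `b₀`**: the centres `[cst a]` and the canonical atoms `[catom x b]` of the columns `b ≠ b₀` — the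
spanning family of part V's residual elimination. [folklore] -/
def resVec (hc2 : c * c = 1) (b₀ : B) : ZMod (2 * n) ⊕ (ZMod (2 * n) × {b : B // b ≠ b₀}) → (CMF G c →₀ ℤ)
  | Sum.inl a => Finsupp.single (cst θ hθ hθc a) 1
  | Sum.inr xb => Finsupp.single (catom θ hθ hθc hc2 xb.1 xb.2.1) 1

variable [Fintype B] [DecidableEq B]

/-- **The profile type `prof Q`**: the columns `b ∈ Q` sit at the arc `1`, the others at the arc `0` (`P ∈ prof Q ↔ ((θP).1 − [(θP).2 ∈ Q]).val < n`).
[folklore] -/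
def prof (Q : Finset B) : CMF G c :=
  ⟨univ.filter fun P => ((θ P).1 - (if (θ P).2 ∈ Q then 1 else 0)).val < n, by
    intro x
    simp only [mem_filter, mem_univ, true_and, fst_c_mul θ hθ hθc, snd_c_mul θ hθ hθc, add_sub_right_comm]
    exact lt_iff_not_lt_add_n _⟩

omit [Fintype B] in
/-- Membership in a profile type. [folklore] -/
@[simp] theorem mem_prof (Q : Finset B) (P : G) :
    P ∈ (prof θ hθ hθc Q).1 ↔ ((θ P).1 - (if (θ P).2 ∈ Q then 1 else 0)).val < n := by
  simp [prof]

omit [Fintype B] in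
/-- Membership of `θ⁻¹(x, b)` in a profile type. [folklore] -/
theorem symm_mem_prof (Q : Finset B) (x : ZMod (2 * n)) (b : B) :
    θ.symm (x, b) ∈ (prof θ hθ hθc Q).1 ↔ (x - (if b ∈ Q then 1 else 0)).val < n := by
  rw [mem_prof, Equiv.apply_symm_apply]

/-- **The upper star** `wplus x = Σ_b [catom x b] − (|B| − 1)[cst x] − [cst (x + 1)]`: the star form of the centre `cst (x+1)` about the centre
`cst x` (a Hodge relation). [folklore] -/
def wplus (hc2 : c * c = 1) (x : ZMod (2 * n)) : CMF G c →₀ ℤ :=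
  (∑ b : B, Finsupp.single (catom θ hθ hθc hc2 x b) 1) - ((Fintype.card B : ℤ) - 1) • Finsupp.single (cst θ hθ hθc x) 1
    - Finsupp.single (cst θ hθ hθc (x + 1)) 1

end Vocabulary

end

end Summit.HodgeConjecture.CorCM.Census.TwistGeneration
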